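import Mathlib
import Summits.Ventures.DiscreteObjects.Mahler.SubLehmerKernelConstraints
import Summits.Ventures.DiscreteObjects.Mahler.LehmerExactMeasure

/-!
# An irreducible sub-Lehmer polynomial has degree at least `4` (venture `DiscreteObjects`, target L)

Cell `pub-namedobj`, seat `pub-namedobj-mahler` (gen 8). Framing: lottery ticket; floor = certified
bounds/negative ranges.

Unconditional small-degree exclusion: an irreducible `P ∈ ℤ[X]` with `1 < M(P) < M(L)` is reciprocal of even
degree `≥ 2` (`SubLehmerKernelConstraints`); here we rule out degree `2`: such a `P` would be
`± (x² + t x + 1)`, which is cyclotomic or reducible for `|t| ≤ 2` and has a root of modulus `≥ 3/2` for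
`|t| ≥ 3` (`four_le_natDegree_of_subLehmer_irreducible`).  ([MRW08] gives `≥ 56` conditionally; the
classical unconditional values `M_4 = 1.7221`, …, `M_8 = 1.2806` are computations not reproduced here.)
-/

namespace Summit.Ventures.DiscreteObjects.Mahler

open Polynomial

/-- A monic reciprocal quadratic `x² + t x + 1` is never an irreducible sub-Lehmer polynomial. -/
theorem not_subLehmer_reciprocal_quadratic (t : ℤ) (hirr : Irreducible (X ^ 2 + C t * X + 1 : ℤ[X])) :
    ¬ SubLehmer (X ^ 2 + C t * X + 1 : ℤ[X]) := by
  intro hP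
  have hL := lehmer_measure_upper_bound
  have hQm : (X ^ 2 + C t * X + 1 : ℤ[X]).Monic := by monicity!
  obtain ⟨hM1, hM2⟩ := hP
  by_cases ht : |t| ≤ 2
  · obtain ⟨ht1, ht2⟩ := abs_le.mp ht
    -- `|t| ≤ 1`: cyclotomic (measure 1); `t = ±2`: a square
    rcases lt_trichotomy t (-2) with h | h | h
    · omega
    · -- t = -2 : (X - 1)²
      have hfac : (X ^ 2 + C t * X + 1 : ℤ[X]) = (X - C 1) * (X - C 1) := by
        rw [h]; simp only [map_neg, map_ofNat, map_one]; ring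
      rcases hirr.isUnit_or_isUnit hfac with hu | hu <;>
      · have := natDegree_eq_zero_of_isUnit hu
        rw [natDegree_X_sub_C] at this
        exact one_ne_zero this
    rcases lt_trichotomy t 2 with h' | h' | h'
    · -- |t| ≤ 1: `M = 1`
      have hy1 : (-2 : ℝ) < ((-t : ℤ) : ℝ) := by
        have : -2 < -t := by omega
        exact_mod_cast this
      have hy2 : ((-t : ℤ) : ℝ) < 2 := by
        have : -t < 2 := by omega
        exact_mod_cast this
      have hM : intMahlerMeasure (X ^ 2 + C t * X + 1 : ℤ[X]) = 1 := by
        unfold intMahlerMeasure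
        have hmap : (X ^ 2 + C t * X + 1 : ℤ[X]).map (Int.castRingHom ℂ) =
            X ^ 2 - C ((((-t : ℤ) : ℝ) : ℂ)) * X + 1 := by
          rw [Polynomial.map_add, Polynomial.map_add, Polynomial.map_pow, map_X, Polynomial.map_mul,
            map_C, map_X, Polynomial.map_one]
          have e : ((((-t : ℤ) : ℝ)) : ℂ) = -((Int.castRingHom ℂ) t) := by
            rw [eq_intCast]; push_cast; ring
          rw [e, map_neg]
          ring
        rw [hmap]
        exact mahlerMeasure_quad_of_abs_lt_two hy1 hy2
      linarith
    · -- t = 2 : (X + 1)²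
      have hfac : (X ^ 2 + C t * X + 1 : ℤ[X]) = (X + C 1) * (X + C 1) := by
        rw [h']; simp only [map_ofNat, map_one]; ring
      rcases hirr.isUnit_or_isUnit hfac with hu | hu <;>
      · have := natDegree_eq_zero_of_isUnit hu
        rw [natDegree_X_add_C] at this
        exact one_ne_zero this
    · omega
  · -- `|t| ≥ 3`: the two roots sum to `-t`, so one has modulus `≥ 3/2 > M(L)`
    push Not at ht
    have ht3 : (3 : ℝ) ≤ |(t : ℝ)| := by
      have : 3 ≤ |t| := ht
      exact_mod_cast this
    obtain ⟨r, hr⟩ := IsAlgClosed.exists_pow_nat_eq ((t : ℂ) ^ 2 - 4) (by norm_num : 0 < 2)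
    have hdisc : discrim (1 : ℂ) (t : ℂ) 1 = r * r := by
      rw [discrim]
      linear_combination -hr
    have hroots : ∀ z : ℂ, z = (-(t : ℂ) + r) / (2 * 1) ∨ z = (-(t : ℂ) - r) / (2 * 1) →
        aeval z (X ^ 2 + C t * X + 1 : ℤ[X]) = 0 := by
      intro z hz
      have h := (quadratic_eq_zero_iff one_ne_zero hdisc z).mpr hz
      simp only [map_add, map_pow, aeval_X, map_mul, aeval_C, map_one]
      rw [algebraMap_int_eq, eq_intCast]
      linear_combination h
    have h1 := norm_root_le_intMahlerMeasure hQm (hroots _ (Or.inl rfl))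
    have h2 := norm_root_le_intMahlerMeasure hQm (hroots _ (Or.inr rfl))
    have hsum : (-(t : ℂ) + r) / (2 * 1) + (-(t : ℂ) - r) / (2 * 1) = -(t : ℂ) := by ring
    have htri := norm_add_le ((-(t : ℂ) + r) / (2 * 1)) ((-(t : ℂ) - r) / (2 * 1))
    rw [hsum, norm_neg, Complex.norm_intCast] at htri
    linarith

/-- **An irreducible sub-Lehmer polynomial has degree `≥ 4`** (unconditional). -/
theorem four_le_natDegree_of_subLehmer_irreducible {P : ℤ[X]} (hirr : Irreducible P) (hP : SubLehmer P) :
    4 ≤ P.natDegree := by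
  obtain ⟨hrev, ⟨heven, hd2⟩, -⟩ := subLehmer_irreducible_constraints hirr hP
  by_contra hlt
  push Not at hlt
  have hd : P.natDegree = 2 := by obtain ⟨k, hk⟩ := heven; omega
  -- leading coefficient `s = ±1`, constant coefficient `= s` (reciprocal), middle coefficient `t`
  have hL := lehmer_measure_upper_bound
  have hlc1 : |P.leadingCoeff| = 1 := by
    have h := abs_leadingCoeff_le_intMahlerMeasure P
    have hne : P.leadingCoeff ≠ 0 := leadingCoeff_ne_zero.mpr hirr.ne_zero
    have h1 : (1 : ℤ) ≤ |P.leadingCoeff| := Int.one_le_abs hne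
    have h2 : (|P.leadingCoeff| : ℝ) < 2 := by linarith [hP.2]
    have h2' : |P.leadingCoeff| < 2 := by exact_mod_cast h2
    omega
  set s : ℤ := P.leadingCoeff with hs
  set t : ℤ := P.coeff 1 with ht
  have hs2 : s * s = 1 := by
    rcases abs_eq (by norm_num : (0 : ℤ) ≤ 1) |>.mp hlc1 with h | h <;> rw [h] <;> norm_num
  have hc0 : P.coeff 0 = s := by rw [hs, ← coeff_zero_reverse, hrev]
  have hc2 : P.coeff 2 = s := by rw [hs, ← coeff_natDegree, hd]
  have hPeq : P = C s * (X ^ 2 + C (s * t) * X + 1) := by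
    have h := P.as_sum_range_C_mul_X_pow
    rw [hd, Finset.sum_range_succ, Finset.sum_range_succ, Finset.sum_range_succ, Finset.sum_range_zero,
      zero_add, hc0, hc2, ← ht] at h
    rw [h]
    have e : C t = C s * C (s * t) := by rw [← map_mul, ← mul_assoc, hs2, one_mul]
    rw [e]
    ring
  -- the monic quadratic `Q = x² + (st) x + 1` is irreducible and sub-Lehmer as well
  set Q : ℤ[X] := X ^ 2 + C (s * t) * X + 1 with hQ
  have hsu : IsUnit (C s : ℤ[X]) := Polynomial.isUnit_C.mpr (isUnit_of_dvd_one ⟨s, hs2.symm⟩)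
  have hQirr : Irreducible Q := by
    have h := hirr
    rw [hPeq] at h
    exact (irreducible_isUnit_mul hsu).mp h
  have hMQ : intMahlerMeasure Q = intMahlerMeasure P := by
    rw [hPeq, intMahlerMeasure_mul]
    have : intMahlerMeasure (C s) = 1 := by
      unfold intMahlerMeasure
      rw [map_C, mahlerMeasure_const, eq_intCast, Complex.norm_intCast]
      have : |(s : ℝ)| = 1 := by exact_mod_cast hlc1
      exact this
    rw [this, one_mul]
  have hQsub : SubLehmer Q := by
    unfold SubLehmer at hP ⊢
    rw [hMQ]; exact hP
  exact not_subLehmer_reciprocal_quadratic (s * t) hQirr hQsub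

end Summit.Ventures.DiscreteObjects.Mahler
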